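import Literature.MathematicalPhysics.QuantumFieldTheory.Balaban1983to89.T4HistoryLipschitzLastCoupling

/-!
# T4HistoryLipschitzWitness (v1) — a JOINT NON-VACUITY WITNESS of the NE9-P2 end-to-end theorems: every displayed binder of
`CubeChart.ne9_and_fadingMemory_of_decay` (and of its last-coupling-analytic form `…_of_decay_holo`) PROVED for one concrete
recursion with genuine memory, on the torus cube chart

Trunk: ConstructiveQFT / Bałaban 1983–89, T⁴ output-rate estimate NE9 (coupling-history Lipschitz continuity with fading
memory, `T4OutputRate.NE9` / `T4OutputRate.FadingMemory`), lineage NE9-P2 (inductive route: a Lipschitz modulus propagated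
through the renormalization-group recursion, fading factor explicit per step).  Rung (B)+1 on a FIXED FINITE T⁴ — not
infinite volume, not a mass gap, not the Clay problem.

WHAT THIS LEAF DOES (harness hygiene, NOT an estimate).  The lineage's end-to-end theorem
`T4HistoryLipschitzCubeGeometry.CubeChart.ne9_and_fadingMemory_of_decay` derives `NE9 ∧ FadingMemory` from ≈ 45 displayed
binders: the printed-STRUCTURE shapes of the recursion ([I] (0.23) p.256, (2.12)–(2.13) p.268; [II] (1.23) p.7, (1.33) p.9,
(2.13)–(2.14) pp.14–15) — `ScaleZeroFree`, `AdmissibleTerms`, `AdmRestrict`, `ChannelAdditive`, `ChannelStepSum`,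
`ChannelSizeAtStepNN`, `Factorises`, `LastCouplingLipschitz`, the read-out `ρ` with its weighted law, the shape `hΨ` of the
new-term map, the occupation bound `s₀ < R₀` — the regularity data of averaged exp-evaluation activities, (A) the decay of
the configuration-free majorant, and (C) scalar smallness conditions.  A long displayed list invites the question whether it
is JOINTLY satisfiable by non-degenerate data (no two binders contradictory; no binder forcing the memoryless or the sticky
regime of `T4HistoryLipschitzRecursion` §7).  This leaf answers it in the kernel: on the torus cube chart `torusChart ν N`
(cubes = the sites of `Fin ν → ZMod (N+1)`, wall adjacency, degree `2ν`) it DEFINES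
* a channel with GEOMETRIC MEMORY `T_k(H) = Σ_{j ≤ k} (½)^{k−j}·H(X₀ⱼ)` reading the term of EVERY earlier creation step `j` on the
  one-cube reference domain `X₀ⱼ` with the weight `ω^{k−j}`, `ω = ½` — the creation-step-weighted shape this lineage reads in
  [II] Lemma 1 ((1.24) p.7 with the factor `L^jη = L^{−(k−j)}`, p.8 l.9–10), neither the memoryless toy channel of
  `T4HistoryLipschitzActivity` §5 nor the sticky channel of `T4HistoryLipschitzRecursion` §7;
* activities of the displayed averaged exp-evaluation type, `ε·y^{#γ}·e^{−R₀}·exp(Q(0))` for a polymer `γ` (a finite family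
  of cubes) and a table `Q : ℝ →ᵇ ℂ` (Dirac parameter measure; coefficient `1`, evaluation point `0`), so that the new term
  `Re Σ_{K ∈ clus X} Φ^T(K)·∏_{γ∈K} act(γ)(Q)` is a genuine polymer cluster sum over the families of connected cube families
  covering `X`, NONLINEAR (exponential) in the channel output;
* the new-term map `Ψ_k(s, P)(X) = e^{−d(X)}·s + Re(new term at the table ρ(P))` with an explicit, Lipschitz last-coupling
  part, and the functional `E` BY THE RECURSION: the channel output `p_k(g)` by the one-step recursion
  `p_{k+1} = ½·p_k + Ψ_k(g_k, p_k)(X₀_{k+1})`, `p₀ = 0`, and `E(g)(X) = Ψ_{k}(g_k, p_k(g))(X)` on creation step `k + 1`, `0` on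
  creation step `0`;
and PROVES every binder of the theorem for these data — the occupation bound `|p_k| ≤ 4 < R₀ = 20` by induction from the
Kotecký–Preiss pin bound of the new term (§4; the pattern of `kpToySeq_abs_le` one level up, the KP condition itself being
DERIVED from the decay (A) by `T4HistoryLipschitzEntropy`), (A) with equality, (C) with `a₁ = d₁ = κ = θ = 1`,
`y = e^{−(2+2ν)}`, `ε = 1/(2ν+1)` — and obtains (§5) `NE9 E W 1 (prodModuli 1 (¾)) ∧ FadingMemory (4/3) (¾) (…)` on every
window of histories with `|g_i| ≤ 1`: fading rate `ω + 4a₁τ̄/(R₀ − s₀) = ½ + ¼ = ¾ < 1`.  §6 does the same for the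
last-coupling-analytic form `T4HistoryLipschitzLastCoupling.ne9_and_fadingMemory_of_decay_holo` (the explicit part
`e^{−d(X)}·s` is the restriction of an affine entire function, bounded by `4e^{−d(X)}` on the disc of radius 3: binder
`HoloInLastCoupling` with `B ≡ 4`, margin `ϱ = 1`).  §1 supplies the one kernel lemma the induction needs and the tree lacks:
the pin bound of the new term under the Gâteaux binder `PotentialKPG` (twin of `norm_newTerm_le_of_potentialKP`).

WHAT IT DOES NOT DO.  It closes NO estimate of the manuscripts and moves no count (cell rule D9): the witness is a toy
inhabitant of displayed hypotheses.  The lineage's located walls are untouched and remain displayed in the end-to-end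
theorems: (A) the decay of the configuration-free majorant UNIFORMLY over tables of norm `< R₀` ([II] (2.15) → (2.38) printed
for one table; cell GAPS G-ne9p2-5 (i)), (L) holomorphy in the last coupling with a margin ([I] p.263 «It is a C^∞-function
of g_{j−1} ∈ [0, γ], (or analytic)», qualitative; `HoloInLastCoupling`), the occupation/ratio condition (G-ne9p2-3), and the
creation-step-weighted reading of [II] Lemma 1 (G-ne9p2-4, supported by cross-reading).  BetaPertH / (B) / (B^μ) are not in
this module's cone and are not hidden anywhere by it.

ABSOLUTE RULE respected: nothing is cited as a fact; [I] = Bałaban CMP 109 (1987), [II] = Bałaban CMP 116 (1988) are quoted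
for the TYPES the toy data imitate, by page; everything is kernel-proved here or in the imported tree files.

References: [Balaban1987RG1] T. Bałaban, CMP 109 (1987), (0.23) p.256, p.263, (2.12)–(2.13) p.268; [Balaban1988RG2Cluster]
T. Bałaban, CMP 116 (1988), (1.24) p.7, p.8, (1.33) p.9, (2.11)–(2.14) pp.14–15, (2.30) p.18, Lemma 3 (2.38) p.20;
[KoteckyPreiss1986] R. Kotecký, D. Preiss, CMP 103 (1986), (1)–(3).
-/

noncomputable section

namespace Literature.MathematicalPhysics.QuantumFieldTheory.Balaban1983to89.T4HistoryLipschitzWitness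

open scoped BigOperators
open Metric Set MeasureTheory BoundedContinuousFunction
open Literature.Probability.LatticeModels
open Literature.MathematicalPhysics.QuantumFieldTheory.Balaban1983to89.T4OutputRate
open Literature.MathematicalPhysics.QuantumFieldTheory.Balaban1983to89.T4ActivityLipschitz
open Literature.MathematicalPhysics.QuantumFieldTheory.Balaban1983to89.T4HistoryLipschitzRecursion
open Literature.MathematicalPhysics.QuantumFieldTheory.Balaban1983to89.T4HistoryLipschitzOuter
open Literature.MathematicalPhysics.QuantumFieldTheory.Balaban1983to89.T4HistoryLipschitzActivity
open Literature.MathematicalPhysics.QuantumFieldTheory.Balaban1983to89.T4HistoryLipschitzEntropy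
open Literature.MathematicalPhysics.QuantumFieldTheory.Balaban1983to89.T4HistoryLipschitzCubeGeometry
open Literature.MathematicalPhysics.QuantumFieldTheory.Balaban1983to89.T4HistoryLipschitzLastCoupling
open Literature.MathematicalPhysics.QuantumFieldTheory.Balaban1983to89.T4HistoryLipschitzActivity (ClusterGeom)

/-! ## §1 The pin bound of the new term under POTENTIAL-KPG (kernel) -/

section NewTermBound

variable {C : Carriers} (G : ClusterGeom C) {Bg : Type} {Pot : Type*} [NormedAddCommGroup Pot] [NormedSpace ℂ Pot]

/-- **The decay bound of the new term on the ball under the Gâteaux binder** (twin of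
`T4HistoryLipschitzActivity.ClusterGeom.norm_newTerm_le_of_potentialKP`; only the domination and the Kotecký–Preiss clause of
`PotentialKPG` are used): `‖new term at Q‖ ≤ B₀ k·e^{−κd(X)}` for every `Q` of the ball — the shape of [II] (2.41) p.21.
[folklore] -/
theorem norm_newTerm_le_of_potentialKPG {W : Set (ℕ → ℝ)} {act : ℕ → ℝ → Bg → Pot → G.P → ℂ}
    {m : ℕ → ℝ → Bg → G.P → ℝ} {a d : G.P → ℝ} {δ : C.Dom → ℝ} {B₀ : ℕ → ℝ} {κ R₀ : ℝ}
    (hKP : G.PotentialKPG W act m a d R₀) (hdec : G.DecayExtract δ d) (hpin : G.PinBudget a δ B₀ κ)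
    {g : ℕ → ℝ} (hg : g ∈ W) {k : ℕ} {U : Bg} {X : C.Dom} (hX : C.scale X = k + 1) {Q : Pot}
    (hQ : Q ∈ ball (0 : Pot) R₀) : ‖G.newTerm act k (g k) U X Q‖ ≤ B₀ k * Real.exp (-(κ * C.d X)) := by
  obtain ⟨ha, hd, hP⟩ := hKP
  obtain ⟨-, hmaj, hkp⟩ := hP g hg k U X hX
  exact (norm_clusterSum_le_of_kp ha hd (kpd_of_norm_le (fun γ hγ => hmaj Q hQ γ hγ) hkp) (G.pin_mem X)
    (G.clus_sub X) (G.clus_pin X) (hdec X)).trans (hpin k X hX)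

end NewTermBound

/-! ## §2 The witness data on the torus cube chart `torusChart ν N` -/

section Data

variable (ν N : ℕ)

/-- the sites (big cubes of one scale): the discrete torus. [folklore] -/
abbrev Site : Type := Fin ν → ZMod (N + 1)

/-- creation step of a domain index of the torus carriers (definitional). [folklore] -/
@[simp] theorem scale_eq (X : (torusCarriers ν N).Dom) : (torusCarriers ν N).scale X = X.1 := rfl

/-- decay length of a domain index of the torus carriers: `#cubes − 1` (definitional). [folklore] -/
theorem d_eq (X : (torusCarriers ν N).Dom) : (torusCarriers ν N).d X = ((X.2.1.card : ℝ) - 1) := rfl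

/-- the cubes of a domain index on the torus chart (definitional). [folklore] -/
@[simp] theorem cubes_eq (X : (torusCarriers ν N).Dom) : (torusChart ν N).cubes X = X.2.1 := rfl

/-- **THE REFERENCE DOMAIN of creation step `j`**: the one-cube family `{0}` at scale `j` (decay length `0`). [folklore] -/
def refDom (j : ℕ) : (torusCarriers ν N).Dom := (j, ⟨{0}, Finset.singleton_nonempty 0⟩)

/-- the reference domain of step `j` has creation step `j`. [folklore] -/
@[simp] theorem scale_refDom (j : ℕ) : (torusCarriers ν N).scale (refDom ν N j) = j := rfl

/-- the reference domain has decay length `0`. [folklore] -/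
@[simp] theorem d_refDom (j : ℕ) : (torusCarriers ν N).d (refDom ν N j) = 0 := by
  simp [d_eq, refDom]

/-- **THE CHANNEL WITH GEOMETRIC MEMORY** (one output index): `T_k(H) = Σ_{j ≤ k} (½)^{k−j}·H(X₀ⱼ)` — every earlier creation
step is read, with the weight `ω^{k−j}`, `ω = ½` (the shape of the factor `L^jη = L^{−(k−j)}` of [II] (1.24) p.7, p.8
l.9–10, in this lineage's reading).  It does not read the comparison history. [cite: Balaban1988RG2Cluster, (1.24) p.7 and p.8] -/
def wT : ℕ → (ℕ → ℝ) → (Unit → (torusCarriers ν N).Dom → ℝ) → Unit → ℝ :=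
  fun k _ H _ => ∑ j ∈ Finset.range (k + 1), (1 / 2 : ℝ) ^ (k - j) * H () (refDom ν N j)

/-- **THE READ-OUT** of a channel output into the table space `ℝ →ᵇ ℂ`: the constant table. [folklore] -/
def wρ : ℕ → (Unit → ℝ) → (ℝ →ᵇ ℂ) := fun _ P => const ℝ ((P () : ℝ) : ℂ)

/-- the decay parameter `y = e^{−(2 + 2ν)}` of the toy activities (beats `e^{a₁ + d₁ + Dθ} = e^{2 + 2ν}`). [folklore] -/
def wy : ℝ := Real.exp (-(2 + 2 * (ν : ℝ)))

/-- the activity size `ε = 1/(2ν + 1)` (so that `ε·θ·(D + 1) = 1 = a₁`). [folklore] -/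
def wε : ℝ := 1 / (2 * (ν : ℝ) + 1)

/-- the parameter measures: Dirac (one parameter value). [folklore] -/
def wμ : ℕ → ℝ → Unit → Finset (Site ν N) → Measure Unit := fun _ _ _ _ => Measure.dirac ()

/-- the prefactors `ε·y^{#γ}·e^{−R₀}`, `R₀ = 20`. [folklore] -/
def wpre : ℕ → ℝ → Unit → Finset (Site ν N) → Unit → ℂ :=
  fun _ _ _ γ _ => ((wε ν * wy ν ^ γ.card * Real.exp (-20) : ℝ) : ℂ)

/-- the coefficients of the evaluation functionals: `1` (one evaluation). [folklore] -/
def wc : ℕ → ℝ → Unit → Finset (Site ν N) → Unit → Unit → ℂ := fun _ _ _ _ _ _ => 1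

/-- the evaluation points: `0`. [folklore] -/
def wpt : ℕ → ℝ → Unit → Finset (Site ν N) → Unit → Unit → ℝ := fun _ _ _ _ _ _ => 0

/-- the operator-norm bounds of the functionals: `1`. [folklore] -/
def wl : ℕ → ℝ → Unit → Finset (Site ν N) → ℝ := fun _ _ _ _ => 1

/-- **THE ACTIVITIES**: averaged exp-evaluation activities `Q ↦ ∫ pre·exp(Σ_Y c(Y)·Q(pt Y)) dμ = ε·y^{#γ}·e^{−R₀}·exp(Q(0))`
(the displayed type of `CubeChart.ne9_and_fadingMemory_of_decay`). [folklore] -/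
def wAct : ℕ → ℝ → Unit → (ℝ →ᵇ ℂ) → (torusChart ν N).geom.P → ℂ :=
  (torusChart ν N).geom.avgExpLinearAct (wμ ν N) (wpre ν N)
    fun k s U γ ω => evalFunctional (wc ν N k s U γ ω) (wpt ν N k s U γ ω)

/-- **THE NEW-TERM MAP** `Ψ_k(s, P)(X) = e^{−d(X)}·s + Re(new term of X at the table ρ(P))`: an explicit last-coupling part
(Lipschitz, modulus `1`) plus the localized cluster sum of the activities over the families covering `X` (the shape of [I]
(2.13) p.268 / [II] (2.13) p.14). [cite: Balaban1987RG1, (2.13) p.268] -/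
def wΨ : ℕ → ℝ → (Unit → ℝ) → Unit → (torusCarriers ν N).Dom → ℝ :=
  fun k s P U X => Real.exp (-(1 * (torusCarriers ν N).d X)) * s +
    ((torusChart ν N).geom.newTerm (wAct ν N) k s U X (wρ k P)).re

/-- the activities, hence the new term, do not read the explicit last coupling (definitional). [folklore] -/
theorem wNewTerm_indep (k : ℕ) (s s' : ℝ) (U : Unit) (X : (torusCarriers ν N).Dom) (Q : ℝ →ᵇ ℂ) :
    (torusChart ν N).geom.newTerm (wAct ν N) k s U X Q = (torusChart ν N).geom.newTerm (wAct ν N) k s' U X Q := rfl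

/-- **THE CHANNEL OUTPUT BY RECURSION**: `p₀ = 0`, `p_{k+1} = ½·p_k + Ψ_k(g_k, p_k)(X₀_{k+1})` — the weighted sum of the
reference terms of all creation steps `≤ k + 1`. [folklore] -/
def wOut (g : ℕ → ℝ) : ℕ → ℝ
  | 0 => 0
  | k + 1 => (1 / 2 : ℝ) * wOut g k + wΨ ν N k (g k) (fun _ => wOut g k) () (refDom ν N (k + 1))

/-- the recursion of the channel output, one step. [folklore] -/
theorem wOut_succ (g : ℕ → ℝ) (k : ℕ) :
    wOut ν N g (k + 1) = (1 / 2 : ℝ) * wOut ν N g k + wΨ ν N k (g k) (fun _ => wOut ν N g k) () (refDom ν N (k + 1)) :=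
  rfl

/-- **THE WITNESS FUNCTIONAL**: no term on creation step `0`; on creation step `k + 1` the new-term map at the last coupling
`g_k` and the channel output `p_k(g)` (the shape of [I] (0.23) p.256 / (2.13) p.268). [cite: Balaban1987RG1, (0.23) p.256] -/
def wE : Functional (torusCarriers ν N) Unit :=
  fun g U X => if X.1 = 0 then 0 else wΨ ν N (X.1 - 1) (g (X.1 - 1)) (fun _ => wOut ν N g (X.1 - 1)) U X

end Data

/-! ## §3 The recursion-side binders PROVED for the witness -/

section RecursionSide

variable (ν N : ℕ)

/-- the witness functional on a domain of creation step `k + 1` (definitional unfolding). [folklore] -/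
theorem wE_succ (g : ℕ → ℝ) (U : Unit) (X : (torusCarriers ν N).Dom) {k : ℕ} (hX : (torusCarriers ν N).scale X = k + 1) :
    wE ν N g U X = wΨ ν N k (g k) (fun _ => wOut ν N g k) U X := by
  obtain ⟨n, Y⟩ := X
  change n = k + 1 at hX
  subst hX
  simp [wE]

/-- the witness functional vanishes on creation step `0`. [folklore] -/
theorem wE_zero (g : ℕ → ℝ) (U : Unit) (X : (torusCarriers ν N).Dom) (hX : (torusCarriers ν N).scale X = 0) :
    wE ν N g U X = 0 := by
  obtain ⟨n, Y⟩ := X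
  change n = 0 at hX
  subst hX
  simp [wE]

/-- `ScaleZeroFree` for the witness. [folklore] -/
theorem w_scaleZeroFree (W : Set (ℕ → ℝ)) : ScaleZeroFree (C := torusCarriers ν N) (wE ν N) W := by
  intro g _ g' _ U X hX
  rw [wE_zero ν N g U X hX, wE_zero ν N g' U X hX]

/-- `AdmissibleTerms` for the witness: the class of ALL families of terms. [folklore] -/
theorem w_admissible (W : Set (ℕ → ℝ)) : AdmissibleTerms (C := torusCarriers ν N) (wE ν N) W Set.univ :=
  ⟨fun _ _ => Set.mem_univ _, fun _ _ _ _ => Set.mem_univ _⟩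

/-- `AdmRestrict` for the class of all families. [folklore] -/
theorem w_admRestrict : AdmRestrict (C := torusCarriers ν N) (Bg := Unit) Set.univ :=
  ⟨fun _ _ _ => Set.mem_univ _, fun _ _ _ => Set.mem_univ _⟩

/-- `ChannelAdditive`: the channel is linear in the families of terms. [folklore] -/
theorem w_channelAdditive : ChannelAdditive (C := torusCarriers ν N) (Bg := Unit) Set.univ (wT ν N) := by
  intro k s H₁ _ H₂ _ y
  simp only [wT, Pi.sub_apply, mul_sub, Finset.sum_sub_distrib]

/-- the channel on a family supported at ONE creation step `j ≤ k` reads only the reference term of that step. [folklore] -/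
theorem wT_of_supported {k j : ℕ} (hjk : j ≤ k) (s : ℕ → ℝ) (H : Unit → (torusCarriers ν N).Dom → ℝ)
    (hH : ∀ (U : Unit) (X : (torusCarriers ν N).Dom), (torusCarriers ν N).scale X ≠ j → H U X = 0) (y : Unit) :
    wT ν N k s H y = (1 / 2 : ℝ) ^ (k - j) * H () (refDom ν N j) := by
  simp only [wT]
  rw [Finset.sum_eq_single j]
  · intro i _ hij
    rw [hH () (refDom ν N i) hij, mul_zero]
  · intro hj
    exact absurd (Finset.mem_range.2 (Nat.lt_succ_of_le hjk)) hj

/-- the channel on the restriction of a family to the creation step `j ≤ k`. [folklore] -/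
theorem wT_restrictScale {k j : ℕ} (hjk : j ≤ k) (s : ℕ → ℝ) (H : Unit → (torusCarriers ν N).Dom → ℝ) (y : Unit) :
    wT ν N k s (restrictScale j H) y = (1 / 2 : ℝ) ^ (k - j) * H () (refDom ν N j) := by
  rw [wT_of_supported ν N hjk s (restrictScale j H) (fun U X hX => restrictScale_of_ne H hX) y,
    restrictScale_of_eq H (scale_refDom ν N j)]

/-- `ChannelStepSum`: the channel output is the sum of its outputs on the one-step restrictions. [folklore] -/
theorem w_channelStepSum : ChannelStepSum (C := torusCarriers ν N) (Bg := Unit) Set.univ (wT ν N) := by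
  intro k s H _ y
  rw [Finset.sum_congr rfl fun j hj =>
    wT_restrictScale ν N (Nat.lt_succ_iff.1 (Finset.mem_range.1 hj)) s H y]
  rfl

/-- `ChannelSizeAtStepNN` with `κ = 1`, weights `wt ≡ 1` and the GEOMETRIC creation-step coefficients `τ k j = (½)^{k−j}`.
[folklore] -/
theorem w_channelSizeAtStepNN :
    ChannelSizeAtStepNN (C := torusCarriers ν N) (Bg := Unit) Set.univ (wT ν N) 1 (fun _ _ => 1)
      (fun k j => (1 / 2 : ℝ) ^ (k - j)) := by
  intro k j hjk s H _ hH M hM hB y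
  rw [wT_of_supported ν N hjk s H hH y, abs_mul, abs_of_nonneg (by positivity), one_mul]
  refine mul_le_mul_of_nonneg_left ?_ (by positivity)
  simpa using hB () (refDom ν N j) (scale_refDom ν N j)

/-- **THE CHANNEL OUTPUT ON THE WITNESS IS THE RECURSIVELY DEFINED `p_k`** (telescoping over the creation steps). [folklore] -/
theorem wT_wE (g s : ℕ → ℝ) : ∀ k : ℕ, wT ν N k s (wE ν N g) = fun _ => wOut ν N g k
  | 0 => by
      funext y
      simp only [wT, zero_add, Finset.sum_range_one, Nat.sub_self, pow_zero, one_mul]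
      rw [wE_zero ν N g () _ (scale_refDom ν N 0)]
      rfl
  | k + 1 => by
      funext y
      have ih := congrFun (wT_wE g s k) y
      simp only [wT] at ih ⊢
      rw [Finset.sum_range_succ, Nat.sub_self, pow_zero, one_mul, wOut_succ,
        wE_succ ν N g () (refDom ν N (k + 1)) (scale_refDom ν N (k + 1)), ← ih, Finset.mul_sum]
      congr 1
      refine Finset.sum_congr rfl fun j hj => ?_
      have hjk : j ≤ k := Nat.lt_succ_iff.1 (Finset.mem_range.1 hj)
      rw [show k + 1 - j = (k - j) + 1 by omega, pow_succ]
      ring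

/-- `Factorises`: on creation step `k + 1` the witness IS the new-term map at the last coupling and the channel output.
[folklore] -/
theorem w_factorises (W : Set (ℕ → ℝ)) : Factorises (C := torusCarriers ν N) (wE ν N) W (wT ν N) (wΨ ν N) := by
  intro g _ k U X hX
  rw [wE_succ ν N g U X hX, wT_wE ν N g g k]

/-- `LastCouplingLipschitz` with modulus `lam ≡ 1`: the explicit part `e^{−d(X)}·s` (the channel does not read the
comparison history). [folklore] -/
theorem w_lastCoupling (W : Set (ℕ → ℝ)) :
    LastCouplingLipschitz (C := torusCarriers ν N) (wE ν N) W (wT ν N) (wΨ ν N) 1 fun _ => 1 := by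
  intro g _ g' _ k U X _
  rw [wT_wE ν N g g k, wT_wE ν N g g' k]
  have e : wΨ ν N k (g k) (fun _ => wOut ν N g k) U X - wΨ ν N k (g' k) (fun _ => wOut ν N g k) U X =
      Real.exp (-(1 * (torusCarriers ν N).d X)) * (g k - g' k) := by
    simp only [wΨ]
    rw [wNewTerm_indep ν N k (g' k) (g k)]
    ring
  rw [e, abs_mul, abs_of_pos (Real.exp_pos _)]
  exact le_of_eq (by simp)

/-- the read-out law: distances of constant tables are dominated by the weighted majorant (`wt ≡ 1`). [folklore] -/
theorem w_read : ∀ (k : ℕ) (P P' : Unit → ℝ) (M : ℝ),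
    (∀ y, |P y - P' y| ≤ (fun (_ : ℕ) (_ : Unit) => (1 : ℝ)) k y * M) → ‖wρ k P - wρ k P'‖ ≤ M := by
  intro k P P' M h
  have h1 : |P () - P' ()| ≤ M := by simpa using h ()
  have hM : 0 ≤ M := (abs_nonneg _).trans h1
  refine (BoundedContinuousFunction.norm_le hM).2 fun x => ?_
  simp only [wρ, BoundedContinuousFunction.coe_sub, Pi.sub_apply, const_apply, ← Complex.ofReal_sub, Complex.norm_real,
    Real.norm_eq_abs]
  exact h1

/-- the norm of a read-out table is the size of the channel output. [folklore] -/
theorem norm_wρ (k : ℕ) (P : Unit → ℝ) : ‖wρ k P‖ = |P ()| := by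
  simp only [wρ, norm_const_eq, Complex.norm_real, Real.norm_eq_abs]

/-- the shape `hΨ`: the table-dependent part of the new-term map is the cluster sum. [folklore] -/
theorem w_psi_sub : ∀ (k : ℕ) (s : ℝ) (P P' : Unit → ℝ) (U : Unit) (X : (torusCarriers ν N).Dom),
    wΨ ν N k s P U X - wΨ ν N k s P' U X =
      ((torusChart ν N).geom.newTerm
            ((torusChart ν N).geom.avgExpLinearAct (wμ ν N) (wpre ν N) fun k s U γ ω =>
              evalFunctional (wc ν N k s U γ ω) (wpt ν N k s U γ ω))
            k s U X (wρ k P) -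
          (torusChart ν N).geom.newTerm
            ((torusChart ν N).geom.avgExpLinearAct (wμ ν N) (wpre ν N) fun k s U γ ω =>
              evalFunctional (wc ν N k s U γ ω) (wpt ν N k s U γ ω))
            k s U X (wρ k P')).re := by
  intro k s P P' U X
  simp only [wΨ, wAct, Complex.sub_re, add_sub_add_left_eq_sub]

end RecursionSide

/-! ## §4 The activity-side binders PROVED, the derived Kotecký–Preiss bound, and the occupation bound by induction -/

section ActivitySide

variable (ν N : ℕ)

/-- `0 ≤ y`. [folklore] -/
theorem wy_nonneg : 0 ≤ wy ν := (Real.exp_pos _).le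

/-- `0 ≤ ε`. [folklore] -/
theorem wε_nonneg : 0 ≤ wε ν := by unfold wε; positivity

/-- integrability of the prefactors (constant in the parameter, Dirac measure). [folklore] -/
theorem w_pre_integrable (k : ℕ) (s : ℝ) (U : Unit) (γ : Finset (Site ν N)) :
    Integrable (wpre ν N k s U γ) (wμ ν N k s U γ) := by
  simp only [wμ]
  exact integrable_const _

/-- measurability of the coefficients (constant). [folklore] -/
theorem w_c_meas (k : ℕ) (s : ℝ) (U : Unit) (γ : Finset (Site ν N)) (Y : Unit) :
    AEStronglyMeasurable (fun ω => wc ν N k s U γ ω Y) (wμ ν N k s U γ) :=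
  aestronglyMeasurable_const

/-- measurability of the evaluation points (constant). [folklore] -/
theorem w_pt_meas (k : ℕ) (s : ℝ) (U : Unit) (γ : Finset (Site ν N)) (Y : Unit) :
    Measurable fun ω => wpt ν N k s U γ ω Y :=
  measurable_const

/-- the norm bound of the coefficients: `Σ_Y ‖c(Y)‖ = 1 ≤ l = 1`. [folklore] -/
theorem w_l_bound (k : ℕ) (s : ℝ) (U : Unit) (γ : Finset (Site ν N)) (ω : Unit) :
    ∑ Y, ‖wc ν N k s U γ ω Y‖ ≤ wl ν N k s U γ := by
  simp [wc, wl]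

/-- **(A) FOR THE WITNESS, WITH EQUALITY**: the configuration-free majorant `∫ ‖pre‖·e^{l R₀} dμ` of the polymer `γ` is
`ε·y^{#γ}`. [folklore] -/
theorem w_majorant (k : ℕ) (s : ℝ) (U : Unit) (γ : Finset (Site ν N)) :
    (torusChart ν N).geom.avgExpLinearMajorant (wμ ν N) (wpre ν N) (wl ν N) 20 k s U γ = wε ν * wy ν ^ γ.card := by
  simp only [ClusterGeom.avgExpLinearMajorant, wμ, wpre, wl, integral_dirac, Complex.norm_real, Real.norm_eq_abs]
  rw [abs_of_nonneg (by have := wε_nonneg ν; have := wy_nonneg ν; positivity), mul_assoc, ← Real.exp_add]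
  norm_num

/-- (A) in the displayed form: the decay of the majorant on every step volume at the occurring couplings. [folklore] -/
theorem w_decay (W : Set (ℕ → ℝ)) : ∀ g ∈ W, ∀ (k : ℕ) (U : Unit) (X : (torusCarriers ν N).Dom),
    (torusCarriers ν N).scale X = k + 1 → ∀ γ' ∈ (torusChart ν N).vol X,
      (torusChart ν N).geom.avgExpLinearMajorant (wμ ν N) (wpre ν N) (wl ν N) 20 k (g k) U γ' ≤
        (fun _ : ℕ => wε ν) k * wy ν ^ γ'.card := by
  intro g _ k U X _ γ' _
  rw [w_majorant]

/-- (C) the entropy inequality `y·e^{a₁ + d₁}·e^{Dθ} ≤ θ` with `a₁ = d₁ = θ = 1`, `D = 2ν`, `y = e^{−(2+2ν)}` (equality).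
[folklore] -/
theorem w_theta : wy ν * Real.exp (1 + 1) * Real.exp (((2 * ν : ℕ) : ℝ) * 1) ≤ 1 := by
  rw [wy, ← Real.exp_add, ← Real.exp_add]
  push_cast
  rw [show -(2 + 2 * (ν : ℝ)) + (1 + 1) + 2 * (ν : ℝ) * 1 = 0 by ring, Real.exp_zero]

/-- (C) the smallness `ε·θ·(D + 1) ≤ a₁` with `ε = 1/(2ν+1)`, `θ = a₁ = 1`, `D = 2ν` (equality). [folklore] -/
theorem w_eps_theta (k : ℕ) : (fun _ : ℕ => wε ν) k * 1 * (((2 * ν : ℕ) : ℝ) + 1) ≤ 1 := by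
  have h : (0 : ℝ) < 2 * (ν : ℝ) + 1 := by positivity
  simp only [wε, mul_one]
  push_cast
  rw [div_mul_cancel₀ _ h.ne']

/-- **THE DERIVED KOTECKÝ–PREISS BINDER** for the witness activities (∘ `Supported.potentialKPG_of_avgEvalExpLinear_decay` of
`T4HistoryLipschitzEntropy`: KP from the decay (A) and the scalars (C); nothing assumed). [folklore] -/
theorem w_potentialKPG (W : Set (ℕ → ℝ)) :
    (torusChart ν N).geom.PotentialKPG W (wAct ν N)
      ((torusChart ν N).geom.avgExpLinearMajorant (wμ ν N) (wpre ν N) (wl ν N) 20)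
      ((torusChart ν N).supported.sizeWeight 1) ((torusChart ν N).supported.sizeWeight 1) 20 :=
  (torusChart ν N).supported.potentialKPG_of_avgEvalExpLinear_decay (W := W) (ε := fun _ => wε ν) (θ := 1)
    zero_le_one zero_le_one (by norm_num) (w_pre_integrable ν N) (w_c_meas ν N) (w_pt_meas ν N) (w_l_bound ν N)
    (fun _ => wε_nonneg ν) (wy_nonneg ν) (w_decay ν N W) (w_theta ν) (w_eps_theta ν)

/-- **THE PIN BOUND OF THE WITNESS NEW TERM**: at an occurring coupling, on a domain of creation step `k + 1`, for every table of
norm `< R₀ = 20`, `|new term| ≤ e^{−d(X)} ≤ 1` (§1 with the chart's `DecayExtract` / `PinBudget`, `a₁ = d₁ = κ = 1`).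
[folklore] -/
theorem norm_newTerm_le {W : Set (ℕ → ℝ)} {g : ℕ → ℝ} (hg : g ∈ W) {k : ℕ} (U : Unit) {X : (torusCarriers ν N).Dom}
    (hX : (torusCarriers ν N).scale X = k + 1) {Q : ℝ →ᵇ ℂ} (hQ : Q ∈ ball (0 : ℝ →ᵇ ℂ) 20) :
    ‖(torusChart ν N).geom.newTerm (wAct ν N) k (g k) U X Q‖ ≤ Real.exp (-(1 * (torusCarriers ν N).d X)) := by
  have h := norm_newTerm_le_of_potentialKPG (torusChart ν N).geom (w_potentialKPG ν N W)
    ((torusChart ν N).decayExtract zero_le_one) ((torusChart ν N).pinBudget zero_le_one zero_le_one le_rfl) hg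
    (U := U) hX hQ
  simpa using h

/-- the new-term bound without the decay factor: `≤ 1`. [folklore] -/
theorem norm_newTerm_le_one {W : Set (ℕ → ℝ)} {g : ℕ → ℝ} (hg : g ∈ W) {k : ℕ} (U : Unit) {X : (torusCarriers ν N).Dom}
    (hX : (torusCarriers ν N).scale X = k + 1) {Q : ℝ →ᵇ ℂ} (hQ : Q ∈ ball (0 : ℝ →ᵇ ℂ) 20) :
    ‖(torusChart ν N).geom.newTerm (wAct ν N) k (g k) U X Q‖ ≤ 1 := by
  refine (norm_newTerm_le ν N hg U hX hQ).trans ?_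
  rw [Real.exp_le_one_iff, neg_nonpos, one_mul]
  exact (torusCarriers ν N).d_nonneg X

/-- the explicit-coupling weight is at most one: `0 < e^{−d(X)} ≤ 1`. [folklore] -/
theorem expWeight_le_one (X : (torusCarriers ν N).Dom) : Real.exp (-(1 * (torusCarriers ν N).d X)) ≤ 1 := by
  rw [Real.exp_le_one_iff, neg_nonpos, one_mul]
  exact (torusCarriers ν N).d_nonneg X

/-- **THE OCCUPATION BOUND BY INDUCTION** (the pattern of `kpToySeq_abs_le` one level up): on a window of histories with
`|g_i| ≤ 1` the channel outputs satisfy `|p_k| ≤ 4` — `|p_{k+1}| ≤ ½·4 + |g_k| + |new term| ≤ 2 + 1 + 1`, the new term being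
evaluated at a table of norm `|p_k| ≤ 4 < 20`. [folklore] -/
theorem abs_wOut_le {W : Set (ℕ → ℝ)} (hW : ∀ g ∈ W, ∀ i, |g i| ≤ 1) {g : ℕ → ℝ} (hg : g ∈ W) :
    ∀ k, |wOut ν N g k| ≤ 4
  | 0 => by norm_num [wOut]
  | k + 1 => by
      have ih := abs_wOut_le hW hg k
      have hQ : wρ k (fun _ => wOut ν N g k) ∈ ball (0 : ℝ →ᵇ ℂ) 20 := by
        rw [mem_ball_zero_iff, norm_wρ]
        linarith
      have hN := norm_newTerm_le_one ν N hg () (scale_refDom ν N (k + 1)) hQ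
      have hexp := expWeight_le_one ν N (refDom ν N (k + 1))
      have hgk := hW g hg k
      rw [wOut_succ]
      calc |(1 / 2 : ℝ) * wOut ν N g k + wΨ ν N k (g k) (fun _ => wOut ν N g k) () (refDom ν N (k + 1))|
          ≤ |(1 / 2 : ℝ) * wOut ν N g k| + |wΨ ν N k (g k) (fun _ => wOut ν N g k) () (refDom ν N (k + 1))| :=
            abs_add_le _ _
        _ ≤ 2 + (1 + 1) := by
            refine add_le_add ?_ ?_
            · rw [abs_mul, abs_of_pos (by norm_num : (0 : ℝ) < 1 / 2)]
              linarith
            · refine (abs_add_le _ _).trans (add_le_add ?_ ((Complex.abs_re_le_norm _).trans hN))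
              rw [abs_mul, abs_of_pos (Real.exp_pos _)]
              calc Real.exp (-(1 * (torusCarriers ν N).d (refDom ν N (k + 1)))) * |g k| ≤ 1 * 1 :=
                    mul_le_mul hexp hgk (abs_nonneg _) zero_le_one
                _ = 1 := one_mul 1
        _ = 4 := by norm_num

/-- the occupation bound in the displayed form: every occurring read-out table has norm `≤ s₀ = 4`. [folklore] -/
theorem w_occ {W : Set (ℕ → ℝ)} (hW : ∀ g ∈ W, ∀ i, |g i| ≤ 1) :
    ∀ g ∈ W, ∀ g' ∈ W, ∀ k : ℕ, ‖wρ k (wT ν N k g' (wE ν N g))‖ ≤ 4 := by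
  intro g hg g' _ k
  rw [wT_wE ν N g g' k, norm_wρ]
  exact abs_wOut_le ν N hW hg k

/-- the geometric envelope of the creation-step coefficients: `0 ≤ (½)^{k−j} ≤ 1·(½)^{k−j}`. [folklore] -/
theorem w_tau : ∀ k j : ℕ, j ≤ k →
    0 ≤ (fun k j : ℕ => (1 / 2 : ℝ) ^ (k - j)) k j ∧
      (fun k j : ℕ => (1 / 2 : ℝ) ^ (k - j)) k j ≤ 1 * (1 / 2 : ℝ) ^ (k - j) := by
  intro k j _
  exact ⟨by positivity, by simp⟩

end ActivitySide

/-! ## §5 THE JOINT WITNESS: every binder of `CubeChart.ne9_and_fadingMemory_of_decay` discharged, NE9 ∧ FadingMemory with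
the computed constants -/

section Headline

variable (ν N : ℕ)

/-- **JOINT NON-VACUITY OF THE NE9-P2 END-TO-END THEOREM.**  On the torus cube chart `torusChart ν N`, for every window of
histories with `|g_i| ≤ 1`, the recursively defined functional `wE` (channel with geometric memory `ω = ½` over all creation
steps, averaged exp-evaluation activities `ε·y^{#γ}·e^{−R₀}·exp(Q(0))`, new term = the localized polymer cluster sum) satisfies
EVERY displayed binder of `CubeChart.ne9_and_fadingMemory_of_decay` with `κ = a₁ = d₁ = θ = 1`, `R₀ = 20`, `s₀ = 4`,
`τ̄ = ℓ = 1`, and the theorem returns NE9 with the product moduli of rate `ω + 4a₁τ̄/(R₀ − s₀) = ¾` and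
`FadingMemory (4/3) (3/4)`.  A toy inhabitant of displayed hypotheses: closes no estimate of the manuscripts. [folklore] -/
theorem witness_ne9 {W : Set (ℕ → ℝ)} (hW : ∀ g ∈ W, ∀ i, |g i| ≤ 1) :
    NE9 (C := torusCarriers ν N) (wE ν N) W 1 (prodModuli 1 fun _ => (3 : ℝ) / 4) ∧
      FadingMemory ((4 : ℝ) / 3) (3 / 4) (prodModuli 1 fun _ => (3 : ℝ) / 4) := by
  have h := (torusChart ν N).ne9_and_fadingMemory_of_decay (E := wE ν N) (W := W) (Adm := Set.univ) (T := wT ν N)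
    (Ψ := wΨ ν N) (μ := wμ ν N) (pre := wpre ν N) (c := wc ν N) (pt := wpt ν N) (l := wl ν N) (R₀ := 20) (s₀ := 4)
    (ε := fun _ => wε ν) (y := wy ν) (a₁ := 1) (d₁ := 1) (θ := 1) (κ := 1) (ℓ := 1) (τbar := 1) (ω := 1 / 2)
    (wt := fun _ _ => 1) (τ := fun k j => (1 / 2 : ℝ) ^ (k - j)) (lam := fun _ => 1) wρ
    (w_scaleZeroFree ν N W) (w_admissible ν N W) (w_admRestrict ν N) (w_channelAdditive ν N) (w_channelStepSum ν N)
    (w_channelSizeAtStepNN ν N) (w_factorises ν N W) (w_lastCoupling ν N W) w_read (w_psi_sub ν N) (w_occ ν N hW)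
    (by norm_num) (by norm_num) (w_pre_integrable ν N) (w_c_meas ν N) (w_pt_meas ν N) (w_l_bound ν N)
    (fun _ => wε_nonneg ν) (wy_nonneg ν) (w_decay ν N W) (w_theta ν) (w_eps_theta ν) zero_le_one zero_le_one le_rfl
    zero_le_one zero_le_one (by norm_num) (by norm_num) (fun _ => le_rfl) (w_tau)
  have e1 : (1 : ℝ) / 2 + 4 * 1 / (20 - 4) * 1 = 3 / 4 := by norm_num
  have e2 : (1 : ℝ) / (3 / 4) = 4 / 3 := by norm_num
  simp only [e1, e2] at h
  exact h

/-- The memory of the witness is GENUINE and FADING, in numbers: the history bracket of NE9 at creation step `k + 1` weighs the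
coupling `g_i`, `i ≤ k`, with `(¾)^{k−i}` — positive for every earlier step, and summable. [folklore] -/
theorem witness_moduli (k i : ℕ) (hik : i ≤ k) :
    prodModuli 1 (fun _ => (3 : ℝ) / 4) (k + 1) i = (3 / 4 : ℝ) ^ (k - i) := by
  rw [prodModuli_const, if_pos (Nat.lt_succ_of_le hik), one_mul, Nat.add_sub_cancel]

end Headline

/-! ## §6 The same witness for the last-coupling-analytic form (`HoloInLastCoupling`, K3 of the lineage) -/

section Holo

variable (ν N : ℕ)

/-- **`HoloInLastCoupling` FOR THE WITNESS** (`B ≡ 4`, margin `ϱ = 1`): at fixed terms of `g`, the new term as a function of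
the last coupling `s` is `e^{−d(X)}·s + c` with `c` the (coupling-independent) cluster-sum part, `|c| ≤ e^{−d(X)}` — the
restriction of an affine entire function bounded by `4e^{−d(X)}` on the disc `‖z‖ < 3`, which contains the closed unit discs
about the window's coupling values `|g′_k| ≤ 1`. [folklore] -/
theorem w_holo {W : Set (ℕ → ℝ)} (hW : ∀ g ∈ W, ∀ i, |g i| ≤ 1) :
    HoloInLastCoupling (C := torusCarriers ν N) (wE ν N) W (wT ν N) (wΨ ν N) 1 (fun _ => 4) 1 := by
  intro g hg k U X hX
  set c : ℝ := ((torusChart ν N).geom.newTerm (wAct ν N) k (g k) U X (wρ k fun _ => wOut ν N g k)).re with hc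
  have hcb : |c| ≤ Real.exp (-(1 * (torusCarriers ν N).d X)) := by
    have hQ : wρ k (fun _ => wOut ν N g k) ∈ ball (0 : ℝ →ᵇ ℂ) 20 := by
      rw [mem_ball_zero_iff, norm_wρ]
      linarith [abs_wOut_le ν N hW hg k]
    exact (Complex.abs_re_le_norm _).trans (norm_newTerm_le ν N hg U hX hQ)
  refine ⟨fun z => (Real.exp (-(1 * (torusCarriers ν N).d X)) : ℂ) * z + (c : ℂ), ball (0 : ℂ) 3, ?_, ?_, ?_, ?_⟩
  · exact ((differentiable_id.const_mul _).add_const _).differentiableOn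
  · intro z hz
    rw [mem_ball_zero_iff] at hz
    have hw := (Real.exp_pos (-(1 * (torusCarriers ν N).d X))).le
    calc ‖(Real.exp (-(1 * (torusCarriers ν N).d X)) : ℂ) * z + (c : ℂ)‖
        ≤ ‖(Real.exp (-(1 * (torusCarriers ν N).d X)) : ℂ) * z‖ + ‖(c : ℂ)‖ := norm_add_le _ _
      _ = Real.exp (-(1 * (torusCarriers ν N).d X)) * ‖z‖ + |c| := by
          rw [norm_mul, Complex.norm_real, Complex.norm_real, Real.norm_eq_abs, Real.norm_eq_abs, abs_of_nonneg hw]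
      _ ≤ Real.exp (-(1 * (torusCarriers ν N).d X)) * 3 + Real.exp (-(1 * (torusCarriers ν N).d X)) :=
          add_le_add (mul_le_mul_of_nonneg_left hz.le hw) hcb
      _ = (fun _ : ℕ => (4 : ℝ)) k * Real.exp (-(1 * (torusCarriers ν N).d X)) := by ring
  · intro g' hg' z hz
    rw [mem_closedBall, dist_eq_norm] at hz
    rw [mem_ball_zero_iff]
    have h1 : ‖((g' k : ℝ) : ℂ)‖ ≤ 1 := by
      rw [Complex.norm_real, Real.norm_eq_abs]; exact hW g' hg' k
    calc ‖z‖ = ‖(z - ((g' k : ℝ) : ℂ)) + ((g' k : ℝ) : ℂ)‖ := by rw [sub_add_cancel]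
      _ ≤ ‖z - ((g' k : ℝ) : ℂ)‖ + ‖((g' k : ℝ) : ℂ)‖ := norm_add_le _ _
      _ ≤ 1 + 1 := add_le_add hz h1
      _ < 3 := by norm_num
  · intro g' _
    rw [wT_wE ν N g g' k, hc]
    simp only [wΨ]
    rw [wNewTerm_indep ν N k (g' k) (g k)]
    push_cast
    ring

/-- **JOINT NON-VACUITY OF THE LAST-COUPLING-ANALYTIC END-TO-END THEOREM** (`ne9_and_fadingMemory_of_decay_holo`, K3): the same
data with `LastCouplingLipschitz` replaced by `HoloInLastCoupling` (`B ≡ B̄ = 4`, `ϱ = 1`); the theorem returns NE9 with the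
product moduli `16·∏(¾)` and `FadingMemory (64/3) (3/4)`. [folklore] -/
theorem witness_ne9_holo {W : Set (ℕ → ℝ)} (hW : ∀ g ∈ W, ∀ i, |g i| ≤ 1) :
    NE9 (C := torusCarriers ν N) (wE ν N) W 1 (prodModuli 16 fun _ => (3 : ℝ) / 4) ∧
      FadingMemory ((64 : ℝ) / 3) (3 / 4) (prodModuli 16 fun _ => (3 : ℝ) / 4) := by
  have h := ne9_and_fadingMemory_of_decay_holo (torusChart ν N) (E := wE ν N) (W := W) (Adm := Set.univ) (T := wT ν N)
    (Ψ := wΨ ν N) (μ := wμ ν N) (pre := wpre ν N) (c := wc ν N) (pt := wpt ν N) (l := wl ν N) (R₀ := 20) (s₀ := 4)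
    (ε := fun _ => wε ν) (y := wy ν) (a₁ := 1) (d₁ := 1) (θ := 1) (κ := 1) (τbar := 1) (ω := 1 / 2) (ϱ := 1)
    (Bbar := 4) (wt := fun _ _ => 1) (τ := fun k j => (1 / 2 : ℝ) ^ (k - j)) (Bl := fun _ => 4) wρ
    (w_scaleZeroFree ν N W) (w_admissible ν N W) (w_admRestrict ν N) (w_channelAdditive ν N) (w_channelStepSum ν N)
    (w_channelSizeAtStepNN ν N) (w_factorises ν N W) one_pos (w_holo ν N hW) (fun _ => le_rfl) (by norm_num) w_read
    (w_psi_sub ν N) (w_occ ν N hW) (by norm_num) (by norm_num) (w_pre_integrable ν N) (w_c_meas ν N) (w_pt_meas ν N)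
    (w_l_bound ν N) (fun _ => wε_nonneg ν) (wy_nonneg ν) (w_decay ν N W) (w_theta ν) (w_eps_theta ν) zero_le_one
    zero_le_one le_rfl zero_le_one (by norm_num) (by norm_num) (w_tau)
  have e1 : (1 : ℝ) / 2 + 4 * 1 / (20 - 4) * 1 = 3 / 4 := by norm_num
  have e2 : (4 : ℝ) * 4 / 1 = 16 := by norm_num
  have e3 : (16 : ℝ) / (3 / 4) = 64 / 3 := by norm_num
  simp only [e1, e2, e3] at h
  exact h

end Holo

end Literature.MathematicalPhysics.QuantumFieldTheory.Balaban1983to89.T4HistoryLipschitzWitness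

end
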